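import Mathlib

/-!
# Rank of the selected-row coefficient matrix is at most the number of selected rows
(stub `stub_rankLe`)

The stub `stub_rankLe` of the crux `MobiusLadder.QuadraticDigitPhases`
(stmt-QuantumAdvantage-1391), line `Sketch`.

For a quadratic `P` over `𝔽₂` in the bit variables `X₀, …, X_{n-1}`, a finite set of row labels
`B ⊆ ℕ`, a column cut-off `N` and a separation `s`, the line works with the `n × n` matrix over `𝔽₂`
whose entry `(i, j)` is the coefficient of `Xᵢ Xⱼ` in `P` when `i ∈ B`, `j < N` and
`dist i j > s`, and `0` otherwise.  This file proves the trivial bound: its rank is at most `B.card`.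
Every row `i` with `i ∉ B` vanishes, so the matrix is unchanged by left multiplication with the
diagonal `0/1` indicator matrix of the rows in `B`; hence its rank is at most the rank of that
diagonal matrix (`Matrix.rank_mul_le_left`), which is the number of its nonzero diagonal entries
(`Matrix.rank_diagonal`), i.e. `#{i : Fin n | i ∈ B} ≤ B.card` (inject by `Fin.val`).
Elementary linear algebra (folklore); Mathlib only.
-/

set_option linter.dupNamespace false -- D-0017: single-problem summit ⇒ QuantumAdvantage.QuantumAdvantage by design

namespace Summit.QuantumAdvantage.QuantumAdvantage.Theorems.MobiusLadderQuadraticDigitPhasesStubRankLe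

/-- A matrix whose rows outside the index predicate `p` vanish is fixed by left multiplication
with the diagonal indicator matrix of `p`. [folklore] -/
theorem diagonal_indicator_mul_eq {n : ℕ} {R : Type*} [CommSemiring R] (p : Fin n → Prop)
    [DecidablePred p] (M : Matrix (Fin n) (Fin n) R) (hM : ∀ i, ¬ p i → ∀ j, M i j = 0) :
    Matrix.diagonal (fun i => if p i then (1 : R) else 0) * M = M := by
  ext i j
  rw [Matrix.diagonal_mul]
  by_cases hi : p i
  · simp [hi]
  · simp [hi, hM i hi j]

/-- Over a field, a square matrix whose rows outside the index predicate `p` vanish has rank at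
most the number of indices satisfying `p`. [folklore] -/
theorem rank_le_card_of_rows_eq_zero {n : ℕ} {K : Type*} [Field K] [DecidableEq K]
    (p : Fin n → Prop) [DecidablePred p] (M : Matrix (Fin n) (Fin n) K)
    (hM : ∀ i, ¬ p i → ∀ j, M i j = 0) :
    M.rank ≤ Fintype.card {i : Fin n // p i} := by
  have hMw := diagonal_indicator_mul_eq p M hM
  calc M.rank = (Matrix.diagonal (fun i => if p i then (1 : K) else 0) * M).rank := by rw [hMw]
    _ ≤ (Matrix.diagonal (fun i => if p i then (1 : K) else 0)).rank := Matrix.rank_mul_le_left _ _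
    _ = Fintype.card {i : Fin n // (if p i then (1 : K) else 0) ≠ 0} := Matrix.rank_diagonal _
    _ = Fintype.card {i : Fin n // p i} := by
        apply Fintype.card_congr
        apply Equiv.subtypeEquivRight
        intro i
        by_cases hi : p i <;> simp [hi]

/-- The number of indices `i : Fin n` whose value lies in a finite set `B ⊆ ℕ` is at most `B.card`
(inject by `Fin.val`). [folklore] -/
theorem card_subtype_val_mem_le (n : ℕ) (B : Finset ℕ) :
    Fintype.card {i : Fin n // (i : ℕ) ∈ B} ≤ B.card := by
  rw [← Fintype.card_coe B]
  apply Fintype.card_le_of_injective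
    (fun i : {i : Fin n // (i : ℕ) ∈ B} => (⟨((i : Fin n) : ℕ), i.2⟩ : B))
  intro a b hab
  apply Subtype.ext
  apply Fin.ext
  simpa using congrArg Subtype.val hab

/-- **Stub `stub_rankLe`** (structure): the rank over `𝔽₂` of the `n × n` matrix whose entry
`(i, j)` is the coefficient of `Xᵢ Xⱼ` in the quadratic `P` when `i ∈ B`, `j < N` and
`dist i j > s` (else `0`) is at most the number `B.card` of selected rows: every row `i ∉ B`
vanishes, and the rows `i ∈ B` are indexed injectively (via `Fin.val`) by a subset of `B`.
[folklore] -/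
theorem stub_rankLe :
    ∀ (n : ℕ) (P : MvPolynomial (Fin n) (ZMod 2)) (s : ℕ) (B : Finset ℕ) (N : ℕ),
      (Matrix.of fun (i j : Fin n) => if (i : ℕ) ∈ B ∧ (j : ℕ) < N ∧ s < Nat.dist (i : ℕ) (j : ℕ) then MvPolynomial.coeff (Finsupp.single i 1 + Finsupp.single j 1) P else 0).rank ≤ B.card := by
  intro n P s B N
  refine (rank_le_card_of_rows_eq_zero (fun i : Fin n => (i : ℕ) ∈ B) _ ?_).trans
    (card_subtype_val_mem_le n B)
  intro i hi j
  simp [Matrix.of_apply, hi]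

end Summit.QuantumAdvantage.QuantumAdvantage.Theorems.MobiusLadderQuadraticDigitPhasesStubRankLe
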